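import Summits.QuantumFields.GaugeBoot.ClassB
import HarnessLib

/-!
# Geometry of the diagonal mirror `x_i = x_j` in `ℤ^d` (gauge-boot, L3(β) part 1)

HONEST FRAMING (cell `pub-gaugeboot`, page 1 of every file): the venture produces certified bounds
on lattice expectations at stated coupling, gauge group, dimension and torus size; NOT a mass gap,
NOT a continuum limit, NOT a string tension; NOT Yang–Mills-summit-bearing (barriers
`FixedCouplingUltralocality`, `PerturbativeInvisibility`).

This module is the combinatorial part of task L3(β): reflection positivity of FINITE-VOLUME
Wilson states in the diagonal hyperplanes `x_i = x_j` (Kazakov–Zheng's third RP family,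
arXiv:2203.11360 §3.1, arXiv:2404.16925 §3.2, p. 10), which holds for reflection-symmetric finite volumes
with symmetric boundary conditions although it FAILS on the periodic torus
(`DiagonalRPTorusNegative.lean`). Relative to the mirror `x_i = x_j` and the swap
`θ = zdDiagSwap i j`, `Θ = configDiagSwapZd i j` of `ClassB.lean`:

* `DiagRP.edgeSwap i j` — the induced involution of the positively oriented links,
  `(x, k) ↦ (θx, (i j) k)`, with `configDiagSwapZd i j U = U ∘ edgeSwap i j`;
* links split into MIRROR links (`IsMirrorEdge`: inside the hyperplane, direction `∉ {i, j}`,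
  fixed by `edgeSwap`), POSITIVE links (`IsPosEdge`: in the closed half `diagHalfEdges i j` and
  not mirror) and the rest; `edgeSwap` carries positive links OUT of the closed half
  (`not_mem_diagHalfEdges_edgeSwap`);
* plaquettes split into four classes `IsPosPlaq / IsNegPlaq / IsCutPlaq / IsMirrorPlaq`
  (exhaustive and exclusive, `plaqClass_cases` ff.): all links in the closed positive half /
  the mirror image of that / the plaquettes in an `(i, j)`-plane with two corners ON the mirror,
  which the hyperplane CUTS along their diagonal / the plaquettes lying inside the mirror; the
  plaquette involution `plaqSwap i j` exchanges `Pos` and `Neg` and fixes the other two classes.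

Everything here is elementary bookkeeping on `ℤ^d`; no measure theory. The links and holonomies
of the four plaquette classes are treated in `DiagonalRPPlaquettes.lean`, the analytic part in
`DiagonalRPFiniteVolume.lean`.

References: K. Osterwalder, E. Seiler, Ann. Phys. 110 (1978) 440, §2 (reflection positivity of
lattice gauge theories, plaquettes cut by the reflection plane); V. Kazakov, Z. Zheng,
arXiv:2203.11360 §3.1, arXiv:2404.16925 §3.2 and p. 10 (the diagonal family).
-/

noncomputable section

open Literature.Probability.LatticeModels (Site)
open Literature.MathematicalPhysics.QuantumLattice

namespace Summit.QuantumFields.GaugeBoot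

namespace DiagRP

variable {d : ℕ} (i j : Fin d)

/-! ## The swap on sites and links -/

/-- `θ` evaluated: `(θx)_k = x_{(i j) k}`. -/
@[simp] theorem zdDiagSwap_apply (x : Site d) (k : Fin d) :
    zdDiagSwap i j x k = x (Equiv.swap i j k) := rfl

/-- `(θx)_i = x_j`. -/
theorem zdDiagSwap_apply_left (x : Site d) : zdDiagSwap i j x i = x j := by
  simp

/-- `(θx)_j = x_i`. -/
theorem zdDiagSwap_apply_right (x : Site d) : zdDiagSwap i j x j = x i := by
  simp

/-- `θ` is additive and carries the unit vector `e_k` to `e_{(i j) k}`: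
`θ(x + a e_k) = θx + a e_{(i j) k}`. -/
theorem zdDiagSwap_add_single (x : Site d) (k : Fin d) (a : ℤ) :
    zdDiagSwap i j (x + Pi.single k a) = zdDiagSwap i j x + Pi.single (Equiv.swap i j k) a := by
  funext m
  simp only [zdDiagSwap_apply, Pi.add_apply, Pi.single_apply, Equiv.swap_apply_eq_iff]

/-- A site on the mirror (`x_i = x_j`) is fixed by `θ`. -/
theorem zdDiagSwap_of_eq {x : Site d} (hx : x i = x j) : zdDiagSwap i j x = x := by
  funext m
  simp only [zdDiagSwap_apply]
  by_cases hmi : m = i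
  · subst hmi; rw [Equiv.swap_apply_left, hx]
  · by_cases hmj : m = j
    · subst hmj; rw [Equiv.swap_apply_right, hx]
    · rw [Equiv.swap_apply_of_ne_of_ne hmi hmj]

/-- The involution of positively oriented links induced by the diagonal swap:
`(x, k) ↦ (θx, (i j) k)` (no link is reversed). -/
def edgeSwap (e : ZdEdge d) : ZdEdge d := (zdDiagSwap i j e.1, Equiv.swap i j e.2)

/-- `edgeSwap` on components. -/
@[simp] theorem edgeSwap_mk (x : Site d) (k : Fin d) :
    edgeSwap i j (x, k) = (zdDiagSwap i j x, Equiv.swap i j k) := rfl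

/-- `edgeSwap` is an involution. -/
@[simp] theorem edgeSwap_edgeSwap (e : ZdEdge d) : edgeSwap i j (edgeSwap i j e) = e := by
  obtain ⟨x, k⟩ := e
  simp [edgeSwap, Equiv.swap_apply_self]

/-- `edgeSwap` is involutive. -/
theorem edgeSwap_involutive : Function.Involutive (edgeSwap (d := d) i j) :=
  edgeSwap_edgeSwap i j

/-- `edgeSwap` is injective. -/
theorem edgeSwap_injective : Function.Injective (edgeSwap (d := d) i j) :=
  (edgeSwap_involutive i j).injective

/-- The configuration involution of `ClassB.lean` is precomposition with `edgeSwap`. -/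
theorem configDiagSwapZd_apply {G : Type*} [Group G] (U : LGConfig d G) (e : ZdEdge d) :
    configDiagSwapZd i j U e = U (edgeSwap i j e) := rfl

/-! ## Links: mirror links and positive links -/

/-- Membership in the closed half `{x_i ≥ x_j}` (both endpoints), unfolded. -/
theorem mem_diagHalfEdges_iff (e : ZdEdge d) :
    e ∈ diagHalfEdges i j ↔ e.1 j ≤ e.1 i ∧ (e.2 = j → e.1 j + 1 ≤ e.1 i) := Iff.rfl

/-- A MIRROR link: a link lying inside the hyperplane `x_i = x_j` (base point on the mirror,
direction `∉ {i, j}`); these are the links fixed by `edgeSwap`. -/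
def IsMirrorEdge (e : ZdEdge d) : Prop := e.1 i = e.1 j ∧ e.2 ≠ i ∧ e.2 ≠ j

/-- A POSITIVE link: a link of the closed half `{x_i ≥ x_j}` which is not a mirror link. -/
def IsPosEdge (e : ZdEdge d) : Prop := e ∈ diagHalfEdges i j ∧ ¬ IsMirrorEdge i j e

/-- Mirror links lie in the closed half. -/
theorem IsMirrorEdge.mem_diagHalfEdges {e : ZdEdge d} (he : IsMirrorEdge i j e) :
    e ∈ diagHalfEdges i j := by
  obtain ⟨h1, -, h3⟩ := he
  exact ⟨h1.symm.le, fun h => absurd h h3⟩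

/-- The closed half consists of the positive links and the mirror links. -/
theorem mem_diagHalfEdges_iff_pos_or_mirror (e : ZdEdge d) :
    e ∈ diagHalfEdges i j ↔ IsPosEdge i j e ∨ IsMirrorEdge i j e := by
  constructor
  · intro h
    by_cases hm : IsMirrorEdge i j e
    · exact Or.inr hm
    · exact Or.inl ⟨h, hm⟩
  · rintro (h | h)
    · exact h.1
    · exact h.mem_diagHalfEdges

/-- Mirror links are fixed by `edgeSwap`. -/
theorem edgeSwap_of_isMirrorEdge {e : ZdEdge d} (he : IsMirrorEdge i j e) : edgeSwap i j e = e := by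
  obtain ⟨x, k⟩ := e
  obtain ⟨h1, h2, h3⟩ := he
  simp only [edgeSwap_mk, Prod.mk.injEq]
  exact ⟨zdDiagSwap_of_eq i j h1, Equiv.swap_apply_of_ne_of_ne h2 h3⟩

variable {i j}

/-- **`edgeSwap` carries positive links out of the closed half.** -/
theorem not_mem_diagHalfEdges_edgeSwap {e : ZdEdge d} (he : IsPosEdge i j e) :
    edgeSwap i j e ∉ diagHalfEdges i j := by
  obtain ⟨x, k⟩ := e
  obtain ⟨⟨h1, h2⟩, hm⟩ := he
  intro h'
  obtain ⟨h3, h4⟩ := h'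
  simp only [edgeSwap_mk, zdDiagSwap_apply, Equiv.swap_apply_left, Equiv.swap_apply_right,
    Equiv.swap_apply_eq_iff] at h1 h2 h3 h4
  have hx : x i = x j := le_antisymm h3 h1
  by_cases hki : k = i
  · have := h4 hki; omega
  · by_cases hkj : k = j
    · have := h2 hkj; omega
    · exact hm ⟨hx, hki, hkj⟩

/-- A link of the closed half whose image is also in the closed half is a mirror link. -/
theorem isMirrorEdge_of_mem_of_edgeSwap_mem {e : ZdEdge d}
    (he : e ∈ diagHalfEdges i j) (he' : edgeSwap i j e ∈ diagHalfEdges i j) :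
    IsMirrorEdge i j e := by
  by_contra hm
  exact not_mem_diagHalfEdges_edgeSwap ⟨he, hm⟩ he'

variable (i j)

/-! ## Plaquettes: the swap and the four classes -/

/-- `p` has a side in direction `m`. -/
def HasDir (p : ZdPlaquette d) (m : Fin d) : Prop := p.2.1.1 = m ∨ p.2.1.2 = m

/-- `HasDir` is decidable. -/
instance (p : ZdPlaquette d) (m : Fin d) : Decidable (HasDir p m) := by
  unfold HasDir; infer_instance

/-- A CUT plaquette: a plaquette in an `(i, j)`-plane with base point on the mirror; the
hyperplane `x_i = x_j` passes through two of its corners and cuts it along the diagonal. -/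
def IsCutPlaq (p : ZdPlaquette d) : Prop := p.1 i = p.1 j ∧ HasDir p i ∧ HasDir p j

/-- A MIRROR plaquette: all four links inside the hyperplane. -/
def IsMirrorPlaq (p : ZdPlaquette d) : Prop := p.1 i = p.1 j ∧ ¬ HasDir p i ∧ ¬ HasDir p j

/-- A POSITIVE plaquette: all four links in the closed half `{x_i ≥ x_j}`, and not a mirror
plaquette. In coordinates (`c = x_i - x_j` at the base point): `c ≥ 0` if the plaquette has a
side in direction `i` and none in direction `j`, `c ≥ 1` otherwise. -/
def IsPosPlaq (p : ZdPlaquette d) : Prop :=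
  (HasDir p i ∧ ¬ HasDir p j → p.1 j ≤ p.1 i) ∧ (¬ (HasDir p i ∧ ¬ HasDir p j) → p.1 j + 1 ≤ p.1 i)

/-- A NEGATIVE plaquette: the mirror image of a positive one (all links in the closed half
`{x_j ≥ x_i}`, not a mirror plaquette). -/
def IsNegPlaq (p : ZdPlaquette d) : Prop :=
  (HasDir p j ∧ ¬ HasDir p i → p.1 i ≤ p.1 j) ∧ (¬ (HasDir p j ∧ ¬ HasDir p i) → p.1 i + 1 ≤ p.1 j)

/-- `IsCutPlaq` is decidable. -/
instance (p : ZdPlaquette d) : Decidable (IsCutPlaq i j p) := by unfold IsCutPlaq; infer_instance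
/-- `IsMirrorPlaq` is decidable. -/
instance (p : ZdPlaquette d) : Decidable (IsMirrorPlaq i j p) := by
  unfold IsMirrorPlaq; infer_instance
/-- `IsPosPlaq` is decidable. -/
instance (p : ZdPlaquette d) : Decidable (IsPosPlaq i j p) := by unfold IsPosPlaq; infer_instance
/-- `IsNegPlaq` is decidable. -/
instance (p : ZdPlaquette d) : Decidable (IsNegPlaq i j p) := by unfold IsNegPlaq; infer_instance

variable {i j}

/-- **The four classes exhaust the plaquettes.** -/
theorem plaqClass_cases (p : ZdPlaquette d) :
    IsPosPlaq i j p ∨ IsNegPlaq i j p ∨ IsCutPlaq i j p ∨ IsMirrorPlaq i j p := by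
  unfold IsPosPlaq IsNegPlaq IsCutPlaq IsMirrorPlaq
  by_cases hI : HasDir p i <;> by_cases hJ : HasDir p j <;> simp [hI, hJ]
  all_goals omega

/-- Positive and negative are exclusive. -/
theorem IsPosPlaq.not_isNegPlaq {p : ZdPlaquette d} (h : IsPosPlaq i j p) : ¬ IsNegPlaq i j p := by
  unfold IsPosPlaq IsNegPlaq at *
  by_cases hI : HasDir p i <;> by_cases hJ : HasDir p j <;> simp [hI, hJ] at h ⊢
  all_goals omega

/-- Positive and cut are exclusive. -/
theorem IsPosPlaq.not_isCutPlaq {p : ZdPlaquette d} (h : IsPosPlaq i j p) : ¬ IsCutPlaq i j p := by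
  unfold IsPosPlaq IsCutPlaq at *
  by_cases hI : HasDir p i <;> by_cases hJ : HasDir p j <;> simp [hI, hJ] at h ⊢
  all_goals omega

/-- Positive and mirror are exclusive. -/
theorem IsPosPlaq.not_isMirrorPlaq {p : ZdPlaquette d} (h : IsPosPlaq i j p) :
    ¬ IsMirrorPlaq i j p := by
  unfold IsPosPlaq IsMirrorPlaq at *
  by_cases hI : HasDir p i <;> by_cases hJ : HasDir p j <;> simp [hI, hJ] at h ⊢
  all_goals omega

/-- Negative and cut are exclusive. -/
theorem IsNegPlaq.not_isCutPlaq {p : ZdPlaquette d} (h : IsNegPlaq i j p) : ¬ IsCutPlaq i j p := by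
  unfold IsNegPlaq IsCutPlaq at *
  by_cases hI : HasDir p i <;> by_cases hJ : HasDir p j <;> simp [hI, hJ] at h ⊢
  all_goals omega

/-- Negative and mirror are exclusive. -/
theorem IsNegPlaq.not_isMirrorPlaq {p : ZdPlaquette d} (h : IsNegPlaq i j p) :
    ¬ IsMirrorPlaq i j p := by
  unfold IsNegPlaq IsMirrorPlaq at *
  by_cases hI : HasDir p i <;> by_cases hJ : HasDir p j <;> simp [hI, hJ] at h ⊢
  all_goals omega

/-- Cut and mirror are exclusive. -/
theorem IsCutPlaq.not_isMirrorPlaq {p : ZdPlaquette d} (h : IsCutPlaq i j p) :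
    ¬ IsMirrorPlaq i j p := fun h' => h'.2.1 h.2.1

/-- A negative plaquette is neither positive, nor cut, nor mirror — and conversely. -/
theorem isNegPlaq_iff_not (p : ZdPlaquette d) :
    IsNegPlaq i j p ↔ ¬ IsPosPlaq i j p ∧ ¬ IsCutPlaq i j p ∧ ¬ IsMirrorPlaq i j p := by
  constructor
  · exact fun h => ⟨fun h' => h'.not_isNegPlaq h, h.not_isCutPlaq, h.not_isMirrorPlaq⟩
  · rintro ⟨h1, h2, h3⟩
    rcases plaqClass_cases (i := i) (j := j) p with h | h | h | h
    · exact absurd h h1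
    · exact h
    · exact absurd h h2
    · exact absurd h h3

variable (i j)

/-- The mirror image of a plaquette: base point `θx`, directions `{(i j) k, (i j) l}` (re-ordered). -/
def plaqSwap (p : ZdPlaquette d) : ZdPlaquette d :=
  if h : Equiv.swap i j p.2.1.1 < Equiv.swap i j p.2.1.2 then
    (zdDiagSwap i j p.1, ⟨(Equiv.swap i j p.2.1.1, Equiv.swap i j p.2.1.2), h⟩)
  else
    (zdDiagSwap i j p.1, ⟨(Equiv.swap i j p.2.1.2, Equiv.swap i j p.2.1.1),
      lt_of_le_of_ne (not_lt.1 h) fun h' => p.2.2.ne ((Equiv.swap i j).injective h'.symm)⟩)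

/-- The base point of the mirror image. -/
@[simp] theorem plaqSwap_fst (p : ZdPlaquette d) : (plaqSwap i j p).1 = zdDiagSwap i j p.1 := by
  unfold plaqSwap; split_ifs <;> rfl

/-- The mirror image has a side in direction `m` iff the plaquette has one in direction
`(i j) m`. -/
theorem hasDir_plaqSwap (p : ZdPlaquette d) (m : Fin d) :
    HasDir (plaqSwap i j p) m ↔ HasDir p (Equiv.swap i j m) := by
  unfold plaqSwap HasDir
  split_ifs <;> simp only [Equiv.swap_apply_eq_iff]
  all_goals exact Or.comm

/-- Direction `i` of the image corresponds to direction `j`. -/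
theorem hasDir_plaqSwap_left (p : ZdPlaquette d) : HasDir (plaqSwap i j p) i ↔ HasDir p j := by
  rw [hasDir_plaqSwap, Equiv.swap_apply_left]

/-- Direction `j` of the image corresponds to direction `i`. -/
theorem hasDir_plaqSwap_right (p : ZdPlaquette d) : HasDir (plaqSwap i j p) j ↔ HasDir p i := by
  rw [hasDir_plaqSwap, Equiv.swap_apply_right]

/-- `plaqSwap` when the swap preserves the order of the two directions. -/
theorem plaqSwap_of_lt (x : Site d) {k l : Fin d} (hkl : k < l)
    (h : Equiv.swap i j k < Equiv.swap i j l) :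
    plaqSwap i j (x, ⟨(k, l), hkl⟩) = (zdDiagSwap i j x, ⟨(Equiv.swap i j k, Equiv.swap i j l), h⟩) := by
  unfold plaqSwap
  simp only [dif_pos h]

/-- `plaqSwap` when the swap reverses the order of the two directions. -/
theorem plaqSwap_of_not_lt (x : Site d) {k l : Fin d} (hkl : k < l)
    (h : ¬ Equiv.swap i j k < Equiv.swap i j l) :
    plaqSwap i j (x, ⟨(k, l), hkl⟩) = (zdDiagSwap i j x, ⟨(Equiv.swap i j l, Equiv.swap i j k),
      lt_of_le_of_ne (not_lt.1 h) fun h' => hkl.ne ((Equiv.swap i j).injective h'.symm)⟩) := by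
  unfold plaqSwap
  simp only [dif_neg h]

/-- `plaqSwap` is an involution. -/
@[simp] theorem plaqSwap_plaqSwap (p : ZdPlaquette d) : plaqSwap i j (plaqSwap i j p) = p := by
  obtain ⟨x, ⟨⟨k, l⟩, hkl⟩⟩ := p
  have hkl' : k < l := hkl
  by_cases h1 : Equiv.swap i j k < Equiv.swap i j l
  · rw [plaqSwap_of_lt i j x hkl' h1, plaqSwap_of_lt i j _ h1 (by simpa [Equiv.swap_apply_self] using hkl')]
    simp [Equiv.swap_apply_self, zdDiagSwap_zdDiagSwap]
  · rw [plaqSwap_of_not_lt i j x hkl' h1,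
      plaqSwap_of_not_lt i j _ _ (by simpa [Equiv.swap_apply_self] using not_lt.2 hkl'.le)]
    simp [Equiv.swap_apply_self, zdDiagSwap_zdDiagSwap]

variable {i j}

/-- **`plaqSwap` exchanges negative and positive plaquettes.** -/
theorem isPosPlaq_plaqSwap_iff (p : ZdPlaquette d) : IsPosPlaq i j (plaqSwap i j p) ↔ IsNegPlaq i j p := by
  unfold IsPosPlaq IsNegPlaq
  simp only [hasDir_plaqSwap_left, hasDir_plaqSwap_right, plaqSwap_fst, zdDiagSwap_apply,
    Equiv.swap_apply_left, Equiv.swap_apply_right]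

/-- `plaqSwap` exchanges positive and negative plaquettes. -/
theorem isNegPlaq_plaqSwap_iff (p : ZdPlaquette d) : IsNegPlaq i j (plaqSwap i j p) ↔ IsPosPlaq i j p := by
  rw [← isPosPlaq_plaqSwap_iff, plaqSwap_plaqSwap]

/-- `plaqSwap` preserves the cut plaquettes. -/
theorem isCutPlaq_plaqSwap_iff (p : ZdPlaquette d) : IsCutPlaq i j (plaqSwap i j p) ↔ IsCutPlaq i j p := by
  unfold IsCutPlaq
  simp only [hasDir_plaqSwap_left, hasDir_plaqSwap_right, plaqSwap_fst, zdDiagSwap_apply,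
    Equiv.swap_apply_left, Equiv.swap_apply_right]
  constructor
  · rintro ⟨h1, h2, h3⟩; exact ⟨h1.symm, h3, h2⟩
  · rintro ⟨h1, h2, h3⟩; exact ⟨h1.symm, h3, h2⟩

/-- `plaqSwap` preserves the mirror plaquettes. -/
theorem isMirrorPlaq_plaqSwap_iff (p : ZdPlaquette d) :
    IsMirrorPlaq i j (plaqSwap i j p) ↔ IsMirrorPlaq i j p := by
  unfold IsMirrorPlaq
  simp only [hasDir_plaqSwap_left, hasDir_plaqSwap_right, plaqSwap_fst, zdDiagSwap_apply,
    Equiv.swap_apply_left, Equiv.swap_apply_right]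
  constructor
  · rintro ⟨h1, h2, h3⟩; exact ⟨h1.symm, h3, h2⟩
  · rintro ⟨h1, h2, h3⟩; exact ⟨h1.symm, h3, h2⟩

/-- **Mirror plaquettes are fixed by `plaqSwap`.** -/
theorem plaqSwap_of_isMirrorPlaq {p : ZdPlaquette d} (hp : IsMirrorPlaq i j p) : plaqSwap i j p = p := by
  obtain ⟨x, ⟨⟨k, l⟩, hkl⟩⟩ := p
  obtain ⟨h1, h2, h3⟩ := hp
  simp only [HasDir, not_or] at h2 h3
  have hk : Equiv.swap i j k = k := Equiv.swap_apply_of_ne_of_ne h2.1 h3.1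
  have hl : Equiv.swap i j l = l := Equiv.swap_apply_of_ne_of_ne h2.2 h3.2
  unfold plaqSwap
  simp only [hk, hl, dif_pos hkl, zdDiagSwap_of_eq i j h1]

end DiagRP

end Summit.QuantumFields.GaugeBoot
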